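import Summits.QuantumFields.YangMills.Theorems.UnitScaleTiltProp7CovOfThm2
import Summits.QuantumFields.YangMills.Theorems.UnitScaleTiltProp7ExistRouteAlphaMin
import HarnessLib

/-!
# Route `UnitScaleTilt`, crux K1 child «MinimiserStabilityRegPr» (stmt-QuantumFields-19200), skeleton v10 stub EX (`stub_existenceMinimalOrbit`),
# route (α) of record `{C-min, COV}` (OWNER RULING g25-№1 §B) — **THE STUB EX FROM C-min AND [Balaban1985RegularSpaces] THEOREM 2 BY NAME**:
# `existenceMinimalOrbit_of_Cmin_cov` (w2, p593620) ∘ the COV socket `Prop7CovOfThm2` (w1), at the three interfaces of the tree for Theorem 2 —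
# the based-letters row (T2), the periodic-`ℤᵈ` consumer interface `B8Thm2TorusAt.Thm2TorusAt` of the lit-balaban supplier at `G = SU(2)`, and print's
# quantifier order `B8Thm2TorusAt.Thm2TorusUniform` — the last one also in the registered stub's full `∀ L > 1, ∀ B₃ > 4` shape

Cell `ym3-torus` ∕ width seat `ym-ust-19200-w1` (gen 2; D-0149; HUMAN RULING D-0037 — YM₃ on T³ is ladder rung R3, not the Clay problem).

WHY.  Route (α) into EX is two print statements (w2's spine v2, criticality-free): C-min = [Balaban1985Variational] Props 4–6 with (116) («the solution of
Prop. 6 MINIMISES the chart functional on the (19)-ball»; tree: `B11Prop6Concrete.exists_solution_concrete` at a T³ `SectEDatum` instance + the convexity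
step G-B11-E5R — RULING g25-№1 §B–§C, binding node SUPNORM-CURVED = N06(d = 3)) and COV = [Balaban1985RegularSpaces] Thm 2, criticality-free chart.  The
sibling file `Prop7CovOfThm2` hangs COV by name on the tree's Theorem-2 interfaces; this file composes, so that the day the lit-balaban supplier
(`B8Thm2TorusSupplier` ∕ seat t2s-1, J-SU layers) lands `Thm2TorusAt … (specialUnitaryUnits (Fin 2)) (fun _ => True)` — or print's uniform form — at the
T³ members, EX ⇐ C-min is ONE `exact`, and the (α) DEPMAP edge «EX ⇐ {C-min, [6] Thm 2}» is in the tree by name.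

WHAT IS PROVED (sorry-free, no definition).  **`existenceMinimalOrbit_of_Cmin_thm2`** (EX at `(L, B₃)` ⇐ C-min ∧ row (T2));
**`existenceMinimalOrbit_of_Cmin_thm2TorusAt`** (⇐ C-min ∧ the per-member `Thm2TorusAt` at `SU(2)`, `Reg := True`);
**`existenceMinimalOrbit_of_Cmin_thm2TorusUniform`** (⇐ C-min ∧ `Thm2TorusUniform L β₀ len SU(2) True` at `d = 3`);
**`stub_existenceMinimalOrbit_of_Cmin_thm2TorusUniform`** — the registered text of `stub_existenceMinimalOrbit` (skeleton v10 b15d8e562e446331, shared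
verbatim with line route-R) IN FULL (`∀ L > 1, ∀ B₃ > 4, ∃ a₁′ O₁ …`) from C-min at every `(L, B₃)` and print's uniform Theorem 2 at every block size `L > 1`.

HONEST SCOPE.  COMPOSITIONS only.  C-min and [6] Theorem 2 at a curved background are HYPOTHESES, displayed in full (`hC`; `hT2` ∕ `hThm2` ∕ `hU`); neither is
proved here or anywhere in the tree (Thm 2: the lit-balaban supplier is a theorem modulo sockets — Prop. 5, (1.59) = [B9] Thm 3.3, (1.42); C-min: N06(d = 3) +
G-B11-E5R).  So this is NOT a proof of the stub EX, of the crux, or of anything about the gap; `O₁ = 178·max{1, 3B₀}` and `a₁′` as in w2's spine.  Count-neutral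
helper toward stmt-QuantumFields-19200 (`--supports`); nothing continuum ∕ OS ∕ mass-gap ∕ Clay.

References: T. Bałaban, CMP **102** (1985) 277–309 [Balaban1985Variational] ((14) p.280, (18)–(21) pp.280–281, Prop. 2 p.281, Props 4–6 pp.291–295, (116)
p.295, Prop. 7 and (141)–(142) p.299); CMP **99** (1985) 75–102 [Balaban1985RegularSpaces] ((1.19) p.79, (1.29) p.81, (1.33)–(1.38) p.82, (1.39) and Thm 2 p.83).
-/

noncomputable section

open scoped Matrix.Norms.L2Operator

namespace Summit.QuantumFields.YangMills.Theorems.Prop7ExistOfCminThm2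

open NormedSpace
open Literature.MathematicalPhysics.QuantumFieldTheory.Balaban1983to89
open Literature.MathematicalPhysics.QuantumFieldTheory.Balaban1983to89.T3ContinuumYM3Torus
open Literature.MathematicalPhysics.QuantumFieldTheory.Balaban1983to89.T3UnitLawDensityEML (ℰp)
open Literature.MathematicalPhysics.QuantumFieldTheory.Balaban1983to89.T3DescentFibreTower
open Literature.MathematicalPhysics.QuantumFieldTheory.Balaban1983to89.T3ConstrainedMinimiser
open Literature.MathematicalPhysics.QuantumFieldTheory.Balaban1983to89.T3TiltDescent
open Literature.MathematicalPhysics.QuantumFieldTheory.Balaban1983to89.T3PrintedRegularMinimiser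
open Literature.MathematicalPhysics.QuantumFieldTheory.Balaban1983to89.T3Thm1Carrier
open Literature.MathematicalPhysics.QuantumFieldTheory.Balaban1983to89.T3SectALandauChart
open B7Prop1Explicit renaming Site → LSite
open B7Prop2SpecialUnitary (specialUnitaryUnits)
open B8Eq138LandauZd (IsLandau138)
open B8Thm4TorusAt (torusLam)
open B8Thm2TorusAt (C136T C139T Cond135T Thm2TorusAt Thm2TorusUniform)
open B10Eq27TorusAxialLog (pull unitsField toUField)
open Summit.QuantumFields.YangMills.Theorems.Prop7TPrint
open Summit.QuantumFields.YangMills.Theorems.Prop7SPrint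
open Summit.QuantumFields.YangMills.Theorems.Prop7ExistRouteAlphaMin (existenceMinimalOrbit_of_Cmin_cov)
open Summit.QuantumFields.YangMills.Theorems.Prop7CovOfThm2 (cov_of_thm2 cov_of_thm2TorusAt cov_of_thm2TorusUniform)

variable {L : ℕ}

/-! ## §1 EX at `(L, B₃)` from C-min and [6] Theorem 2 for the based letters (row (T2)) -/

/-- **EX ⇐ C-min ∧ ROW (T2).**  At `L > 1`, `B₃ > 4`: C-min (Prop. 6's solution minimises the chart functional on the (19)-ball, (20), (21); text = w2's
`hC` verbatim) and the existence half of [6] Theorem 2 for print's based letters at the T³ carrier, (3.35)-free (text = the `hT2` socket of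
`Prop7SPrintCond135.prop2Printed_sPrint_of_thm2`, verbatim; constants `B₁, c₁ > 0`) IMPLY the registered text of `stub_existenceMinimalOrbit` at `(L, B₃)`
(`Prop7ExistRouteAlphaMin.existenceMinimalOrbit_of_Cmin_cov` ∘ `Prop7CovOfThm2.cov_of_thm2`).
[cite: Balaban1985Variational, Prop. 7 p.299, Prop. 2 p.281, (116) p.295; Balaban1985RegularSpaces, Thm 2 p.83] -/
theorem existenceMinimalOrbit_of_Cmin_thm2 (hL : 1 < L) {B₃ : ℝ} (hB₃ : 4 < B₃)
    (hC : ∃ B₀ a₄ : ℝ, 0 < B₀ ∧ 0 < a₄ ∧ ∀ (i : Idx L) (ε₁ ε₄ : ℝ), 0 < ε₁ → ε₄ ≤ a₄ → 2 * B₀ * (L : ℝ) ^ 3 * B₃ * ε₁ ≤ ε₄ →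
        ∀ (V : GaugeField (i.1.1.P i.1.2.1) 0 (Matrix.specialUnitaryGroup (Fin 2) ℂ)) (U₀ : GaugeField (i.1.1.P i.1.2.2) 0 (Matrix.specialUnitaryGroup (Fin 2) ℂ)),
          PlaqSmall ε₁ V → RegPr i.1.1 i.1.2.1 i.1.2.2 ((L : ℝ) ^ 3 * B₃ * ε₁) U₀ → CloseAvg i.1.1 i.1.2.1 i.1.2.2 i.2.2.le ((L : ℝ) ^ 3 * ε₁) V U₀ →
          ∃ X : PBond (i.1.1.P i.1.2.2) 0 → Matrix (Fin 2) (Fin 2) ℂ,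
            nMax19 i.1.1 i.1.2.1 i.1.2.2 U₀ X < 3 * B₀ * (L : ℝ) ^ 3 * B₃ * ε₁ ∧ (∀ b : PBond (i.1.1.P i.1.2.2) 0, (X b).IsHermitian ∧ Matrix.trace (X b) = 0) ∧
            AvgCondPrint i.1.1 i.1.2.1 i.1.2.2 i.2.2.le V U₀ X ∧ IsLandauPrint i.1.1 i.1.2.1 i.1.2.2 U₀ X ∧
            ∀ X' : PBond (i.1.1.P i.1.2.2) 0 → Matrix (Fin 2) (Fin 2) ℂ, nMax19 i.1.1 i.1.2.1 i.1.2.2 U₀ X' < ε₄ → (∀ b : PBond (i.1.1.P i.1.2.2) 0, (X' b).IsHermitian ∧ Matrix.trace (X' b) = 0) →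
              AvgCondPrint i.1.1 i.1.2.1 i.1.2.2 i.2.2.le V U₀ X' → IsLandauPrint i.1.1 i.1.2.1 i.1.2.2 U₀ X' →
                wilsonAction4 (emb15 U₀ (expHermField X)) ≤ wilsonAction4 (emb15 U₀ (expHermField X')))
    {B₁ c₁ : ℝ} (hB₁ : 0 < B₁) (hc₁ : 0 < c₁)
    (hT2 : ∀ (F : T3Family), F.L = L → ∀ (n K : ℕ), n < K → ∀ (α₀ α₁ : ℝ), 0 < α₀ → 0 < α₁ → α₀ + α₁ ≤ c₁ →
      ∀ (U₀ U : GaugeField (F.P K) 0 (Matrix.specialUnitaryGroup (Fin 2) ℂ)),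
        RegPr F n K α₀ U₀ → RegPr F n K α₀ U → IsAxialPrint F n K U₀ U →
        Cond135T (F.P K).L (K - n) (pull (bgUnits F K U₀) (basePt F n K)) (pull (bgUnits F K (pert U₀ U)) (basePt F n K)) α₁ →
        ∃ (u : GaugeTransf (F.P K) 0 (Matrix.specialUnitaryGroup (Fin 2) ℂ))
          (U₁ : GaugeField (F.P K) 0 (Matrix.specialUnitaryGroup (Fin 2) ℂ)) (A : PBond (F.P K) 0 → Matrix (Fin 2) (Fin 2) ℂ),
          RestrictedPrint F n K U₀ u ∧ GaugeField.gaugeAct u (emb15 U₀ U₁) = U ∧ (∀ b : PBond (F.P K) 0, IsSelfAdjoint (A b)) ∧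
          (∀ b : PBond (F.P K) 0,
            ((U₁ b : Matrix.specialUnitaryGroup (Fin 2) ℂ) : Matrix (Fin 2) (Fin 2) ℂ) = exp (Complex.I • ((eta F n K) • A b))) ∧
          (∃ (β₀ B₂ : ℝ) (len : LSite (F.P K).d → ℝ),
            C136T (F.P K).L (K - n) (eta F n K) β₀ B₁ B₂ len (α₀ + α₁) (pull (bgUnits F K U₀) (basePt F n K)) (pull A (basePt F n K))) ∧
          IsLandau138 (F.P K).L (K - n) (eta F n K) (Set.univ : Set (LSite (F.P K).d)) (torusLam (K - n))
            (pull (bgUnits F K U₀) (basePt F n K)) (pull A (basePt F n K)) ∧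
          C139T (F.P K).L (K - n) (eta F n K) B₁ (α₀ + α₁) (pull (bgUnits F K U₀) (basePt F n K)) (pull A (basePt F n K))) :
    ∃ a₁' O₁ : ℝ, 0 < a₁' ∧ 1 ≤ O₁ ∧
    ∀ (F : T3Family), F.L = L → ∀ (n K : ℕ) (hnK : n < K) (ε₁ : ℝ), 0 < ε₁ →
      ∀ V : GaugeField (F.P n) 0 (Matrix.specialUnitaryGroup (Fin 2) ℂ), PlaqSmall ε₁ V →
        ∀ U₀ : GaugeField (F.P K) 0 (Matrix.specialUnitaryGroup (Fin 2) ℂ), RegPr F n K ((L : ℝ) ^ 3 * B₃ * ε₁) U₀ → U₀ ∈ fibre F ℰp n K hnK.le V →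
          ε₁ ≤ a₁' → ∃ U ∈ regFibrePr F n K hnK.le (O₁ * (L : ℝ) ^ 3 * B₃ * ε₁) V,
            IsMinOn (fun W : GaugeField (F.P K) 0 (Matrix.specialUnitaryGroup (Fin 2) ℂ) => wilsonAction4 W)
              (regFibrePr F n K hnK.le (O₁ * (L : ℝ) ^ 3 * B₃ * ε₁) V) U :=
  existenceMinimalOrbit_of_Cmin_cov hL hB₃ hC (cov_of_thm2 (by linarith) hB₁ hc₁ hT2)

/-! ## §2 EX at `(L, B₃)` from C-min and the periodic-`ℤᵈ` interface `Thm2TorusAt` at `G = SU(2)` -/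

/-- **EX ⇐ C-min ∧ `Thm2TorusAt … (specialUnitaryUnits (Fin 2)) (fun _ => True)` AT EVERY MEMBER** — the junction with the lit-balaban supplier's consumer
interface: if [6] Theorem 2 holds for `Ω_j = T_η` (period `sitesPerDir 0`, `k = K − n` levels, `η = L^{−k}`, `SU(2) ⊂ M₂(ℂ)`, constants `B₁, c₁`, any
`β₀, B₂, len`, no regularity rider) at every member with `F.L = L`, `n < K`, then C-min implies the registered text of `stub_existenceMinimalOrbit` at `(L, B₃)`
(`existenceMinimalOrbit_of_Cmin_cov` ∘ `Prop7CovOfThm2.cov_of_thm2TorusAt`).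
[cite: Balaban1985Variational, Prop. 7 p.299, Prop. 2 p.281; Balaban1985RegularSpaces, Thm 2 p.83, p.77 («Ω_j = T_η for j = 0,1,…,l, l ≤ k»)] -/
theorem existenceMinimalOrbit_of_Cmin_thm2TorusAt (hL : 1 < L) {B₃ : ℝ} (hB₃ : 4 < B₃)
    (hC : ∃ B₀ a₄ : ℝ, 0 < B₀ ∧ 0 < a₄ ∧ ∀ (i : Idx L) (ε₁ ε₄ : ℝ), 0 < ε₁ → ε₄ ≤ a₄ → 2 * B₀ * (L : ℝ) ^ 3 * B₃ * ε₁ ≤ ε₄ →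
        ∀ (V : GaugeField (i.1.1.P i.1.2.1) 0 (Matrix.specialUnitaryGroup (Fin 2) ℂ)) (U₀ : GaugeField (i.1.1.P i.1.2.2) 0 (Matrix.specialUnitaryGroup (Fin 2) ℂ)),
          PlaqSmall ε₁ V → RegPr i.1.1 i.1.2.1 i.1.2.2 ((L : ℝ) ^ 3 * B₃ * ε₁) U₀ → CloseAvg i.1.1 i.1.2.1 i.1.2.2 i.2.2.le ((L : ℝ) ^ 3 * ε₁) V U₀ →
          ∃ X : PBond (i.1.1.P i.1.2.2) 0 → Matrix (Fin 2) (Fin 2) ℂ,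
            nMax19 i.1.1 i.1.2.1 i.1.2.2 U₀ X < 3 * B₀ * (L : ℝ) ^ 3 * B₃ * ε₁ ∧ (∀ b : PBond (i.1.1.P i.1.2.2) 0, (X b).IsHermitian ∧ Matrix.trace (X b) = 0) ∧
            AvgCondPrint i.1.1 i.1.2.1 i.1.2.2 i.2.2.le V U₀ X ∧ IsLandauPrint i.1.1 i.1.2.1 i.1.2.2 U₀ X ∧
            ∀ X' : PBond (i.1.1.P i.1.2.2) 0 → Matrix (Fin 2) (Fin 2) ℂ, nMax19 i.1.1 i.1.2.1 i.1.2.2 U₀ X' < ε₄ → (∀ b : PBond (i.1.1.P i.1.2.2) 0, (X' b).IsHermitian ∧ Matrix.trace (X' b) = 0) →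
              AvgCondPrint i.1.1 i.1.2.1 i.1.2.2 i.2.2.le V U₀ X' → IsLandauPrint i.1.1 i.1.2.1 i.1.2.2 U₀ X' →
                wilsonAction4 (emb15 U₀ (expHermField X)) ≤ wilsonAction4 (emb15 U₀ (expHermField X')))
    {B₁ c₁ : ℝ} (hB₁ : 0 < B₁) (hc₁ : 0 < c₁)
    (hThm2 : ∀ (F : T3Family), F.L = L → ∀ (n K : ℕ), n < K →
      ∃ (β₀ B₂ : ℝ) (len : LSite (F.P K).d → ℝ),
        Thm2TorusAt (F.P K).L (K - n) ((((F.P K).sitesPerDir 0 : ℕ) : ℤ)) (eta F n K) β₀ B₁ B₂ c₁ len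
          (specialUnitaryUnits (Fin 2)) (fun _ => True)) :
    ∃ a₁' O₁ : ℝ, 0 < a₁' ∧ 1 ≤ O₁ ∧
    ∀ (F : T3Family), F.L = L → ∀ (n K : ℕ) (hnK : n < K) (ε₁ : ℝ), 0 < ε₁ →
      ∀ V : GaugeField (F.P n) 0 (Matrix.specialUnitaryGroup (Fin 2) ℂ), PlaqSmall ε₁ V →
        ∀ U₀ : GaugeField (F.P K) 0 (Matrix.specialUnitaryGroup (Fin 2) ℂ), RegPr F n K ((L : ℝ) ^ 3 * B₃ * ε₁) U₀ → U₀ ∈ fibre F ℰp n K hnK.le V →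
          ε₁ ≤ a₁' → ∃ U ∈ regFibrePr F n K hnK.le (O₁ * (L : ℝ) ^ 3 * B₃ * ε₁) V,
            IsMinOn (fun W : GaugeField (F.P K) 0 (Matrix.specialUnitaryGroup (Fin 2) ℂ) => wilsonAction4 W)
              (regFibrePr F n K hnK.le (O₁ * (L : ℝ) ^ 3 * B₃ * ε₁) V) U :=
  existenceMinimalOrbit_of_Cmin_cov hL hB₃ hC (cov_of_thm2TorusAt (by linarith) hB₁ hc₁ hThm2)

/-! ## §3 EX from C-min and print's quantifier order `Thm2TorusUniform` — at one `(L, B₃)`, and the registered stub text in full -/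

/-- **EX ⇐ C-min ∧ `Thm2TorusUniform L β₀ len SU(2) True` (d = 3)** — print's «There exist constants B₁, B₂(β₀), c₁ such that for arbitrary U₀, U′U₀ …», one
triple for every `k ≥ 1`, period, spacing: then C-min implies the registered text of `stub_existenceMinimalOrbit` at `(L, B₃)`
(`existenceMinimalOrbit_of_Cmin_cov` ∘ `Prop7CovOfThm2.cov_of_thm2TorusUniform`).
[cite: Balaban1985Variational, Prop. 7 p.299, Prop. 2 p.281; Balaban1985RegularSpaces, Thm 2 p.83, p.83 (sentence after (1.39))] -/
theorem existenceMinimalOrbit_of_Cmin_thm2TorusUniform (hL : 1 < L) {B₃ : ℝ} (hB₃ : 4 < B₃)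
    (hC : ∃ B₀ a₄ : ℝ, 0 < B₀ ∧ 0 < a₄ ∧ ∀ (i : Idx L) (ε₁ ε₄ : ℝ), 0 < ε₁ → ε₄ ≤ a₄ → 2 * B₀ * (L : ℝ) ^ 3 * B₃ * ε₁ ≤ ε₄ →
        ∀ (V : GaugeField (i.1.1.P i.1.2.1) 0 (Matrix.specialUnitaryGroup (Fin 2) ℂ)) (U₀ : GaugeField (i.1.1.P i.1.2.2) 0 (Matrix.specialUnitaryGroup (Fin 2) ℂ)),
          PlaqSmall ε₁ V → RegPr i.1.1 i.1.2.1 i.1.2.2 ((L : ℝ) ^ 3 * B₃ * ε₁) U₀ → CloseAvg i.1.1 i.1.2.1 i.1.2.2 i.2.2.le ((L : ℝ) ^ 3 * ε₁) V U₀ →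
          ∃ X : PBond (i.1.1.P i.1.2.2) 0 → Matrix (Fin 2) (Fin 2) ℂ,
            nMax19 i.1.1 i.1.2.1 i.1.2.2 U₀ X < 3 * B₀ * (L : ℝ) ^ 3 * B₃ * ε₁ ∧ (∀ b : PBond (i.1.1.P i.1.2.2) 0, (X b).IsHermitian ∧ Matrix.trace (X b) = 0) ∧
            AvgCondPrint i.1.1 i.1.2.1 i.1.2.2 i.2.2.le V U₀ X ∧ IsLandauPrint i.1.1 i.1.2.1 i.1.2.2 U₀ X ∧
            ∀ X' : PBond (i.1.1.P i.1.2.2) 0 → Matrix (Fin 2) (Fin 2) ℂ, nMax19 i.1.1 i.1.2.1 i.1.2.2 U₀ X' < ε₄ → (∀ b : PBond (i.1.1.P i.1.2.2) 0, (X' b).IsHermitian ∧ Matrix.trace (X' b) = 0) →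
              AvgCondPrint i.1.1 i.1.2.1 i.1.2.2 i.2.2.le V U₀ X' → IsLandauPrint i.1.1 i.1.2.1 i.1.2.2 U₀ X' →
                wilsonAction4 (emb15 U₀ (expHermField X)) ≤ wilsonAction4 (emb15 U₀ (expHermField X')))
    {β₀ : ℝ} {len : LSite 3 → ℝ}
    (hU : Thm2TorusUniform (𝔸 := Matrix (Fin 2) (Fin 2) ℂ) L β₀ len (specialUnitaryUnits (Fin 2)) (fun _ _ _ _ => True)) :
    ∃ a₁' O₁ : ℝ, 0 < a₁' ∧ 1 ≤ O₁ ∧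
    ∀ (F : T3Family), F.L = L → ∀ (n K : ℕ) (hnK : n < K) (ε₁ : ℝ), 0 < ε₁ →
      ∀ V : GaugeField (F.P n) 0 (Matrix.specialUnitaryGroup (Fin 2) ℂ), PlaqSmall ε₁ V →
        ∀ U₀ : GaugeField (F.P K) 0 (Matrix.specialUnitaryGroup (Fin 2) ℂ), RegPr F n K ((L : ℝ) ^ 3 * B₃ * ε₁) U₀ → U₀ ∈ fibre F ℰp n K hnK.le V →
          ε₁ ≤ a₁' → ∃ U ∈ regFibrePr F n K hnK.le (O₁ * (L : ℝ) ^ 3 * B₃ * ε₁) V,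
            IsMinOn (fun W : GaugeField (F.P K) 0 (Matrix.specialUnitaryGroup (Fin 2) ℂ) => wilsonAction4 W)
              (regFibrePr F n K hnK.le (O₁ * (L : ℝ) ^ 3 * B₃ * ε₁) V) U :=
  existenceMinimalOrbit_of_Cmin_cov hL hB₃ hC (cov_of_thm2TorusUniform (by linarith) hU)

/-- **THE REGISTERED TEXT OF `stub_existenceMinimalOrbit` IN FULL (skeleton v10; shared verbatim with line route-R) FROM C-min AT EVERY `(L, B₃)` AND PRINT'S
UNIFORM [6] THEOREM 2 AT EVERY BLOCK SIZE `L > 1`** (d = 3, `SU(2)`, no regularity rider; the Hölder data `β₀, len` may depend on `L`).  A composition; both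
inputs remain hypotheses (C-min: N06(d = 3) + G-B11-E5R; Thm 2: the lit-balaban supplier modulo its sockets) — NOT a proof of the stub.
[cite: Balaban1985Variational, Prop. 7 p.299, Thm 1 p.279 («The constants … depend on d and L only»); Balaban1985RegularSpaces, Thm 2 p.83] -/
theorem stub_existenceMinimalOrbit_of_Cmin_thm2TorusUniform
    (hC : ∀ (L : ℕ), 1 < L → ∀ (B₃ : ℝ), 4 < B₃ →
      ∃ B₀ a₄ : ℝ, 0 < B₀ ∧ 0 < a₄ ∧ ∀ (i : Idx L) (ε₁ ε₄ : ℝ), 0 < ε₁ → ε₄ ≤ a₄ → 2 * B₀ * (L : ℝ) ^ 3 * B₃ * ε₁ ≤ ε₄ →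
        ∀ (V : GaugeField (i.1.1.P i.1.2.1) 0 (Matrix.specialUnitaryGroup (Fin 2) ℂ)) (U₀ : GaugeField (i.1.1.P i.1.2.2) 0 (Matrix.specialUnitaryGroup (Fin 2) ℂ)),
          PlaqSmall ε₁ V → RegPr i.1.1 i.1.2.1 i.1.2.2 ((L : ℝ) ^ 3 * B₃ * ε₁) U₀ → CloseAvg i.1.1 i.1.2.1 i.1.2.2 i.2.2.le ((L : ℝ) ^ 3 * ε₁) V U₀ →
          ∃ X : PBond (i.1.1.P i.1.2.2) 0 → Matrix (Fin 2) (Fin 2) ℂ,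
            nMax19 i.1.1 i.1.2.1 i.1.2.2 U₀ X < 3 * B₀ * (L : ℝ) ^ 3 * B₃ * ε₁ ∧ (∀ b : PBond (i.1.1.P i.1.2.2) 0, (X b).IsHermitian ∧ Matrix.trace (X b) = 0) ∧
            AvgCondPrint i.1.1 i.1.2.1 i.1.2.2 i.2.2.le V U₀ X ∧ IsLandauPrint i.1.1 i.1.2.1 i.1.2.2 U₀ X ∧
            ∀ X' : PBond (i.1.1.P i.1.2.2) 0 → Matrix (Fin 2) (Fin 2) ℂ, nMax19 i.1.1 i.1.2.1 i.1.2.2 U₀ X' < ε₄ → (∀ b : PBond (i.1.1.P i.1.2.2) 0, (X' b).IsHermitian ∧ Matrix.trace (X' b) = 0) →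
              AvgCondPrint i.1.1 i.1.2.1 i.1.2.2 i.2.2.le V U₀ X' → IsLandauPrint i.1.1 i.1.2.1 i.1.2.2 U₀ X' →
                wilsonAction4 (emb15 U₀ (expHermField X)) ≤ wilsonAction4 (emb15 U₀ (expHermField X')))
    (hU : ∀ (L : ℕ), 1 < L → ∃ (β₀ : ℝ) (len : LSite 3 → ℝ),
      Thm2TorusUniform (𝔸 := Matrix (Fin 2) (Fin 2) ℂ) L β₀ len (specialUnitaryUnits (Fin 2)) (fun _ _ _ _ => True)) :
    ∀ (L : ℕ), 1 < L → ∀ (B₃ : ℝ), 4 < B₃ → ∃ a₁' O₁ : ℝ, 0 < a₁' ∧ 1 ≤ O₁ ∧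
    ∀ (F : T3Family), F.L = L → ∀ (n K : ℕ) (hnK : n < K) (ε₁ : ℝ), 0 < ε₁ →
      ∀ V : GaugeField (F.P n) 0 (Matrix.specialUnitaryGroup (Fin 2) ℂ), PlaqSmall ε₁ V →
        ∀ U₀ : GaugeField (F.P K) 0 (Matrix.specialUnitaryGroup (Fin 2) ℂ), RegPr F n K ((L : ℝ) ^ 3 * B₃ * ε₁) U₀ → U₀ ∈ fibre F ℰp n K hnK.le V →
          ε₁ ≤ a₁' → ∃ U ∈ regFibrePr F n K hnK.le (O₁ * (L : ℝ) ^ 3 * B₃ * ε₁) V,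
            IsMinOn (fun W : GaugeField (F.P K) 0 (Matrix.specialUnitaryGroup (Fin 2) ℂ) => wilsonAction4 W)
              (regFibrePr F n K hnK.le (O₁ * (L : ℝ) ^ 3 * B₃ * ε₁) V) U := by
  intro L hL B₃ hB₃
  obtain ⟨β₀, len, h⟩ := hU L hL
  exact existenceMinimalOrbit_of_Cmin_thm2TorusUniform hL hB₃ (hC L hL B₃ hB₃) h

end Summit.QuantumFields.YangMills.Theorems.Prop7ExistOfCminThm2

end
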